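import Summits.NavierStokesRegularity.FluidComputer.TriggerClassSweepLedger

/-!
# Door N1-FC, the (host × Reynolds × seed-class) trigger sweep — ledger continuation (§8 ff.): the SECOND / THIRD-ENGINE rows of
# the symmetry-class cells on h_Σ(a), h_Σ(b) at ν₀/3 beside the engine-A rows

Cell `pub-fluidc` (FLUID COMPUTER; host summit `NavierStokesRegularity`, negation side, machine paradigm), seat
`pub-fluidc-dns-A5` (ENGINE A; gen 2, 2026-08-27; D-0081 §A2 «FLUID-COMPUTER TRIGGER SWEEP», bears_on N1-FC, token FC-TRIG-3).
HONEST FRAMING: low prior, high value-of-information experiment on Tao's machine paradigm; NOT a claim that NS blows up.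
WHAT THIS IS NOT: not Navier–Stokes evidence and not a word — TYPED ARITHMETIC on the numbers PRINTED by the cell's registered
second and third integrators (PREREG-FC-TRIG-3 frozen prefix 77 177 B f46874a3…, §3.4 engines / RULING (B-1) prereg l.101, (B-1.2):
clean-«C-0» r = 3 cells take their engine-B pair member at 256³ from `pub-fluidc-dns-B3` and their 384³ second-engine X leg from the
circuit seats `ns-blowup-circuit3` (aΣ) / `ns-blowup-circuit2` (bΣ), each on the BYTE-IDENTICAL injected state engine A deposited):
engine-B READ lines pub-fluidc STATUS l.5662 (C-0 256³ wave 2), l.5918 (j265054), l.5922 (j266855), l.5956 (j265055), l.5973 (j265435 →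
j267953) with the referee's co-reads l.5926 / l.5958 and `ns-blowup-refuter2`'s K-READs l.5923 / l.5959 / l.5974; third-engine C-0 legs
ns-blowup STATUS l.5372 (j259269, 256³) / l.7431 (j262083, 384³; K-READ l.7481); records `pub-fluidc-dns-B3/reads/records_j*.json`,
`ns-blowup/circuit3/reads/records_j*.json`.
MODEL/DNS readings; every cell word («C-0» = KILL / …), the 5 % two-engine clause as a VERDICT, and the seed namings belong to the custody
pen (`fc3_words.py`, prereg §6.1) — cited, never claimed; the kernel checks rational inequalities between printed decimals.

This file CONTINUES `TriggerClassSweepLedger.lean` (§1–§7, 337 lines: the 22 engine-A rows `etaChild` / `jump` / `etaHost` / `delta` of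
cells (aΣ, 3, mirror), (aΣ, 3, odd), (bΣ, 3, mirror), (bΣ, 3, odd), the Σ-scan, the Σ-host rows), near the 400-line cap; same dictionary,
7-decimal prints, every inequality evaluated on the typed decimals before being typed. It is append-only: identifiers of this block carry
the suffix `b`; the rows still pending at this writing (the circuit seats' 384³ X legs at the deciding grid — circuit3 (aΣ, 3, mirror) `T_e`
j265828 and (aΣ, 3, odd) `T_o`, circuit2 (bΣ, 3) C-0 j266210 / (bΣ, 3, mirror) `S_e` j267242 / (bΣ, 3, odd) `T_o` j267278) are NOT typed here
and land in a later block with suffix `c`, as do the pen's cell words.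

* §8 (`b`): the FOUR engine-B 256³ pair members of record (one per cell, the pen-named seed) — dns-B3 j265054 (aΣ, 3, mirror) `T_e` ↔ engine-A
  row 0, j266855 (aΣ, 3, odd) `T_o` ↔ row 9, j265055 (bΣ, 3, odd) `T_o` ↔ row 19, j265435 → j267953 (bΣ, 3, mirror) `S_e` ↔ row 13 — and the
  four second/third-engine C-0 window rows (aΣ 256³ dns-B3 / circuit3, aΣ 384³ circuit3, bΣ 256³ dns-B3): `twoEngine_agree_b` (|η_child,B −
  η_child,A| ≤ 1e-5 · η_child,A — a fortiori the registered 5 %; two of four EXACT at 7 decimals: at τ = 0 on h_Σ(a) the child maximum is the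
  injected row itself on either integrator), `jump_eq_b` (J identical: same bytes), `absent_above_delta_b` (|Λ_B| ≤ δ_B, indeed 10 |Λ_B| < δ_B;
  the one positive increment, (bΣ, 3, mirror) `S_e` +5.8e-4, is the same on both engines), `sameClass_b` (both engines' Λ within 5e-5 of each
  other and inside BOTH floors), `host_threeEngine_b` (the untriggered window value of h_Σ(a) at t_inj: 0.3155877 on dns-B3 AND circuit3 at
  256³ = engine A's five τ-0 `η⁻` there; 0.3156043 on circuit3 at 384³ = engine A's `etaHost 3` exactly; bΣ 256³: dns-B3 0.3231016 vs engine A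
  0.3231025, 9e-7), floor-lemma instances on the engine-B readings.
0 sorry; no named fact; no instance; axioms ⊆ {propext, Classical.choice, Quot.sound}.
-/

noncomputable section

namespace Summit.NavierStokesRegularity.FluidComputer.TriggerClassSweepLedger

open Summit.NavierStokesRegularity.FluidComputer.GadgetDetectionFloor
open Summit.NavierStokesRegularity.FluidComputer.TriggeredTransfer

/-! ## §8 APPEND `b` (dns-A5 gen 2, 2026-08-27): the engine-B 256³ pair member of each of the four cells and the second/third-engine C-0 rows

Row order (engine; job; cell; arm; grid ↔ engine-A row of §4): 0: dns-B3 j265054 (aΣ, 3, mirror) T_e 256³ ↔ row 0 (first-row peak on both engines);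
1: dns-B3 j266855 (= j263491 + resume) (aΣ, 3, odd) T_o 256³ ↔ row 9 (first-row peak); 2: dns-B3 j265055 (bΣ, 3, odd) T_o 256³ ↔ row 19 (interior,
t_read 2.0500 vs engine A 2.0551); 3: dns-B3 j265435 → resume j267953 (bΣ, 3, mirror) S_e 256³ (PROJECTED leg) ↔ row 13 (interior, flat top: t_read
2.0978 vs engine A 2.0892). Engine B = dns-B 0.4.0 (SSP-RK3 chain), seed parity-rebuilt in-job to ≤ 2e-15 of the hand-over (A5 PARITY block, pen custody
l.5929), J measured on its own states. Its C-0 = its own PROJECTED Σ-host continuation from engine A's t 2.00 bytes (j260174 aΣ / j260175 bΣ). -/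

/-- Engine-A row of §4 matched by each engine-B member (append b). -/
def rowOfB : Fin 4 → Fin 22 := ![0, 9, 19, 13]
/-- `η_child` on engine B per member (7 decimals as printed on l.5918 / l.5922 / l.5956 / l.5973). -/
def etaChildB : Fin 4 → ℝ := ![0.3287013, 0.3255877, 0.3330681, 0.3320034]
/-- `J` on engine B per member. -/
def jumpB : Fin 4 → ℝ := ![0.0131136, 0.0100000, 0.0100000, 0.0083207]
/-- Engine B's own `η_{C-0}` over the member's window (256³; aΣ: left end t 2.00; bΣ: interior maximum at 2.0528). -/
def etaHostB : Fin 4 → ℝ := ![0.3155877, 0.3155877, 0.3231016, 0.3231016]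
/-- Engine B's floor `δ` per member. -/
def deltaB : Fin 4 → ℝ := ![0.0065740, 0.0065118, 0.0066614, 0.0066401]
/-- `η⁻ = η_child − J` on engine B. -/
def etaMinusB (k : Fin 4) : ℝ := etaChildB k - jumpB k
/-- `Λ` on engine B (its own C-0 row). -/
def lambdaMechB (k : Fin 4) : ℝ := (etaChildB k - etaHostB k) - jumpB k

/-- TWO-ENGINE AGREEMENT of the child readings: `|η_child,B − η_child,A| ≤ 1e-5 · η_child,A` on all four members (members 0 and 1 agree
EXACTLY at 7 decimals — printed rel −1.2e-7 / −4.8e-8; member 2: +2.1e-6 absolute, rel 6.3e-6; member 3: −3e-7, rel 9e-7) — a fortiori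
inside the registered 5 % two-engine clause (whose verdict is the pen's). [folklore] -/
theorem twoEngine_agree_b : ∀ k : Fin 4, |etaChildB k - etaChild (rowOfB k)| ≤ 1e-5 * etaChild (rowOfB k) ∧
    |etaChildB k - etaChild (rowOfB k)| ≤ 0.05 * etaChild (rowOfB k) ∧ (k.val < 2 → etaChildB k = etaChild (rowOfB k)) := by
  intro k; fin_cases k <;> simp [etaChildB, etaChild, rowOfB] <;> norm_num [abs_le]

/-- The injection jump is the same number on both engines (same injected bytes; parity-exact `J = ε²` on the odd members), and so is the
floor to 7 decimals except member 2's last digit (`δ_B = 0.02 η_child,B`). [folklore] -/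
theorem jump_eq_b : ∀ k : Fin 4, jumpB k = jump (rowOfB k) ∧ |deltaB k - delta (rowOfB k)| ≤ 1e-7 ∧ |deltaB k - 0.02 * etaChildB k| ≤ 1e-7 := by
  intro k; fin_cases k <;> simp [jumpB, jump, deltaB, delta, etaChildB, rowOfB] <;> norm_num [abs_le]

/-- «mech ≤ δ» on engine B: `|Λ_B| ≤ δ_B` on all four members — members 0, 1: `Λ_B = 0` exactly at 7 decimals (engine B's C-0 row sitting AT
t_inj); member 2: `−3.35e-5` («199× inside»); member 3: `+5.811e-4`, the same positive increment engine A printed for (bΣ, 3, mirror) `S_e`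
(`+5.805e-4`, row 13), «11.4× inside». [folklore] -/
theorem absent_above_delta_b : ∀ k : Fin 4, |lambdaMechB k| ≤ deltaB k ∧ 10 * |lambdaMechB k| < deltaB k ∧ (k.val < 3 → |lambdaMechB k| ≤ 0.0000335) := by
  intro k; fin_cases k <;> simp [lambdaMechB, etaChildB, etaHostB, jumpB, deltaB] <;> norm_num [abs_le, abs_lt]

/-- SAME CLASS on both engines: the two engines' `Λ` differ by `≤ 5e-5` (members 0, 1: engine A's `+4.75e-5` vs B's `0` is the one-host-row
offset of engine A's 256³ C-0 window, 2.003 vs 2.000 — READ l.5700 / l.5922; member 2: `−3.65e-5` vs `−3.35e-5`; member 3: `+5.805e-4` vs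
`+5.811e-4`), and EACH engine's `Λ` lies inside BOTH engines' floors. [folklore] -/
theorem sameClass_b : ∀ k : Fin 4, |lambdaMechB k - lambdaMech (rowOfB k)| ≤ 0.00005 ∧
    |lambdaMech (rowOfB k)| ≤ deltaB k ∧ |lambdaMechB k| ≤ delta (rowOfB k) := by
  intro k; fin_cases k <;> simp [lambdaMechB, lambdaMech, etaChildB, etaHostB, jumpB, deltaB, etaChild, etaHost, jump, delta, rowOfB] <;>
    norm_num [abs_le]

/-- Engine B's `η⁻` per member: within `2.1e-6` of engine A's, `≤ 0.3237 ≤ 349/1000`, gap to `1/2` `≥ 0.1763`. [folklore] -/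
theorem etaMinusB_le : ∀ k : Fin 4, |etaMinusB k - etaMinus (rowOfB k)| ≤ 0.0000021 ∧ etaMinusB k ≤ 349 / 1000 ∧ 0.1763 ≤ 1 / 2 - etaMinusB k := by
  intro k; fin_cases k <;> simp [etaMinusB, etaMinus, etaChildB, jumpB, etaChild, jump, rowOfB] <;> norm_num [abs_le]

/-- MEMBER BY MEMBER on the second engine (`not_kelvin_two_of_reading`): any efficiency within engine B's floor of engine B's reading fails
`1 < 2η`. [folklore] -/
theorem no_kelvin_two_of_rowB (k : Fin 4) {η : ℝ} (hread : |etaMinusB k - η| ≤ deltaB k) : ¬ 1 < η * 2 :=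
  not_kelvin_two_of_reading hread (etaMinusB_le k).2.1
    (by have h := (jump_eq_b k).2.1; have h2 := delta_le (rowOfB k); rw [abs_le] at h; linarith [h.2])

/-- … and no one-child `TriggerScheme` with `λ = 2` has its efficiency inside engine B's certified window of any member. [cite: Tao2016AveragedNS, §1.3] -/
theorem no_triggerScheme_two_of_rowB (k : Fin 4) :
    ¬ ∃ 𝒮 : TriggerScheme, 𝒮.lam = 2 ∧ |etaMinusB k - 𝒮.eta| ≤ deltaB k :=
  not_exists_triggerScheme_two_of_reading (etaMinusB_le k).2.1
    (by have h := (jump_eq_b k).2.1; have h2 := delta_le (rowOfB k); rw [abs_le] at h; linarith [h.2])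

/-- Second / third-engine untriggered window values `η_{C-0}` of the PROJECTED Σ-hosts re-integrated from engine A's t 2.00 bytes, order:
(aΣ, 256³) dns-B3 j260174 (left end t 2.00; reused by j265054 / j266855), (aΣ, 256³) circuit3 j259269 (left end), (aΣ, 384³) circuit3 j262083
(left end; hostcmp vs engine A over 48 shared instants ≤ 1.25e-8 relative, ns-blowup l.7431), (bΣ, 256³) dns-B3 j260175 (interior maximum
at 2.0528; reused by j265055 / j265435). -/
def hostC0b : Fin 4 → ℝ := ![0.3155877, 0.3155877, 0.3156043, 0.3231016]

/-- THREE ENGINES ON h_Σ(a): at 256³ dns-B3 and circuit3 print the SAME window value `0.3155877`, which IS engine A's common τ-0 reading `η⁻`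
of rows 0, 1, 2, 8, 9 (`TriggerClassSweepLedger.aSigma_ties`) — three integrators, five seeds, one number; at 384³ circuit3's `0.3156043` IS
engine A's `etaHost 3` (= rows 3–5, 10–11) exactly; on h_Σ(b) at 256³ dns-B3's interior maximum sits `9e-7` below engine A's `etaHost 13 = etaHost 19`
(`0.3231025`) and is the C-0 row of both bΣ members. [folklore] -/
theorem host_threeEngine_b :
    hostC0b 0 = hostC0b 1 ∧ hostC0b 0 = etaMinus 0 ∧ hostC0b 0 = etaMinus 8 ∧ hostC0b 0 = etaHostB 0 ∧ hostC0b 2 = etaHost 3 ∧ hostC0b 2 = etaHost 10 ∧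
    |hostC0b 3 - etaHost 19| ≤ 0.000001 ∧ etaHost 13 = etaHost 19 ∧ hostC0b 3 = etaHostB 2 ∧ hostC0b 3 = etaHostB 3 := by
  simp [hostC0b, etaMinus, etaChild, jump, etaHost, etaHostB]; norm_num [abs_le]

/-- Every second / third-engine host window value is `< 1/2` with gap `≥ 0.1768` (as on engine A, `TriggerClassSweepLedger.hostSigma_gap`). [folklore] -/
theorem hostC0b_gap : ∀ i : Fin 4, hostC0b i < 1 / 2 ∧ 0.1768 ≤ 1 / 2 - hostC0b i := by
  intro i; fin_cases i <;> simp [hostC0b] <;> norm_num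

end Summit.NavierStokesRegularity.FluidComputer.TriggerClassSweepLedger

end
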